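import Literature.Barriers.PneNP.NaturalProofs
import Literature.Computability.Complexity.PNPNaturalProofsProofs
import Literature.Computability.Complexity.CircuitClassesUniformProofs
import Literature.Computability.MetaComplexity.NaturalProofsProofs
import HarnessLib

/-!
# Barrier catalogue `PneNP`: natural proofs — proofs (Razborov–Rudich 1997, Thm. 4.1)

Sibling proof file of `Literature/Barriers/PneNP/NaturalProofs.lean` (D-0014: the barrier fact is
`def NaturalProofs : Prop`, its discharge is `theorem NaturalProofs_holds : NaturalProofs`; this
file contains theorems only). It discharges

* `NaturalProofs_holds : NaturalProofs` — the natural proofs barrier (Razborov–Rudich 1997,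
  Thm. 4.1: "There is no lower bound proof which is `P/poly`-natural against `P/poly`, unless for
  every `ε > 0` no pseudo-random generator family `Gₖ : {0,1}ᵏ → {0,1}²ᵏ` in `P/poly` has
  hardness `H(Gₖ) ≥ 2^{k^ε}`"; Arora–Barak 2009, Thm. 23.1),

and records the hypothesis-free forms of the readings proved in `NaturalProofs.lean` under
`(h : NaturalProofs)`: no natural proof against `P/poly` (`not_exists_naturalProof_of_hardPRG`),
none that is `P`-natural (`not_exists_P_natural_of_hardPRG`, now also without the hypothesis
`P ⊆ P/poly`, discharged as `P_subset_PPoly_holds`), none of `L ∉ P/poly` for any language `L`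
(`no_naturalProof_for_of_hardPRG`) — each conditional only on the pseudorandomness hypothesis
`HardPRGExist` of the theorem — and what a natural proof proves (`IsNaturalProof.not_mem_PPoly'`,
without the usefulness-bridge hypothesis, discharged as
`isUsefulAgainst_PPoly_of_isUsefulAgainstPPoly_holds`).

## Proof

`NaturalProofs` is by definition (`naturalProofs_iff`) the tree fact
`Literature.Computability.Complexity.natural_proofs_barrier` (`Literature/Computability/Complexity/PNPNaturalProofs.lean`),
which is discharged as `Literature.Computability.Complexity.natural_proofs_barrier_holds` in
`Literature/Computability/Complexity/PNPNaturalProofsProofs.lean`. That proof follows the printed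
one (Razborov–Rudich 1997, proof of Thm. 4.1; Arora–Barak 2009, §23.3, pp. 591–592, with the
Goldreich–Goldwasser–Micali tree of Thm. 9.17, pp. 227–228): the `P/poly`-constructive large
sub-property is a polynomial-size test on truth tables accepting a `2^{-O(n)}` fraction of all
`n`-variable functions; the GGM functions `f_s : {0,1}ⁿ → {0,1}` built from `Gₖ` with
`n = ⌊k^{1/D}⌋`, `1/D < ε`, have circuits of size polynomial in `n`, so by usefulness the test
rejects all of them for large `n`; the hybrid argument over the `2ⁿ - 1` internal nodes of the GGM
tree (`Literature.Computability.MetaComplexity.prgHardness_le_of_test`, `Literature/Computability/MetaComplexity/GGM.lean`)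
converts the test into a `B₂`-circuit of size `2^{O(n)}` with advantage `2^{-O(n)}` against `Gₖ`,
whence `H(Gₖ) ≤ 2^{O(n)} < 2^{k^ε}` for all large `k` — in particular for infinitely many `k`,
which is the (weak, `∃ᶠ`) form vendored in the tree.

## References

* A. A. Razborov, S. Rudich, *Natural proofs*, J. Comput. System Sci. 55 (1997) 24–35, Thm. 4.1
  and its proof (§4); §2 (natural, useful properties). Primary text paywalled (acquisition
  requested); statement as quoted in the tree file `PNPNaturalProofs.lean`.
* S. Arora, B. Barak, *Computational Complexity: A Modern Approach*, CUP 2009, Thm. 23.1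
  (p. 587) and §23.3 (proof, pp. 591–592); Thm. 9.17 (GGM, pp. 227–228); Thm. 6.6
  (`P ⊆ P/poly`).
-/

namespace Literature.Barriers.PneNP

open _root_.Computability Literature.Computability.Complexity Literature.Computability.Complexity.Classes Literature.Computability.MetaComplexity Filter

/-! ### The discharge -/

/-- **Discharge of the natural proofs barrier `NaturalProofs`** (Razborov–Rudich 1997,
Thm. 4.1; Arora–Barak 2009, Thm. 23.1): if `Q` is a `P/poly`-natural combinatorial property
useful against `P/poly`, then for every pseudo-random generator family `G` in `P/poly` and every
`ε > 0`, `H(Gₖ) < 2^{k^ε}` for infinitely many `k`. By `naturalProofs_iff` this is the tree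
theorem `Literature.Computability.Complexity.natural_proofs_barrier_holds` (GGM tree + hybrid argument, see the module
docstring). [cite: RazborovRudich1997, Thm. 4.1] [cite: AroraBarakCC2009, Thm. 23.1 and §23.3 (proof, pp. 591–592)] -/
theorem NaturalProofs_holds : NaturalProofs :=
  naturalProofs_iff.2 natural_proofs_barrier_holds

/-! ### Hypothesis-free readings -/

/-- **No natural proof against `P/poly` if `2^{k^ε}`-hard PRGs in `P/poly` exist**
(Razborov–Rudich 1997, Thm. 4.1, contrapositive; Arora–Barak 2009, Thm. 23.1), now conditional
on the pseudorandomness hypothesis `HardPRGExist` only (`NaturalProofs.not_exists_naturalProof`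
fed with `NaturalProofs_holds`). [cite: RazborovRudich1997, Thm. 4.1] [cite: AroraBarakCC2009, Thm. 23.1] -/
theorem not_exists_naturalProof_of_hardPRG (hG : HardPRGExist) :
    ¬ ∃ Q : CombinatorialProperty, IsNaturalProof Q :=
  NaturalProofs_holds.not_exists_naturalProof hG

/-- **No `P`-natural property useful against `P/poly` if hard PRGs exist** (Razborov–Rudich
1997, Thm. 4.1 with §2: `Γ`-naturality is monotone in `Γ`, and `P ⊆ P/poly`, Arora–Barak 2009,
Thm. 6.6, discharged in the tree as `P_subset_PPoly_holds`). Hypothesis-free form of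
`NaturalProofs.not_exists_P_natural`. [cite: RazborovRudich1997, Thm. 4.1 with §2] [cite: AroraBarakCC2009, Thm. 6.6] -/
theorem not_exists_P_natural_of_hardPRG (hG : HardPRGExist) :
    ¬ ∃ Q : CombinatorialProperty, IsNatural P Q ∧ IsUsefulAgainstPPoly Q :=
  NaturalProofs_holds.not_exists_P_natural hG P_subset_PPoly_holds

/-- **No natural proof of `L ∉ P/poly`, for any language `L`, if hard PRGs exist** — in
particular none of `NP ⊄ P/poly` (`Literature.Computability.Complexity.NPNotSubsetPPoly`, routes PneNP/Circuit, Circuit2).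
Hypothesis-free form of `NaturalProofs.no_naturalProof_for`. [cite: RazborovRudich1997, Thm. 4.1] [cite: AroraBarakCC2009, Thm. 23.1 ("such techniques will not be able to prove NP ⊄ P/poly")] -/
theorem no_naturalProof_for_of_hardPRG (hG : HardPRGExist) (L : Language Bool) :
    ¬ ∃ Q : CombinatorialProperty, IsNaturalProof Q ∧ ∃ᶠ n in atTop, L.sliceFn n ∈ Q n :=
  NaturalProofs_holds.no_naturalProof_for hG L

/-- **What a natural proof proves**, without the bridge hypothesis of
`IsNaturalProof.not_mem_PPoly` (discharged as
`isUsefulAgainst_PPoly_of_isUsefulAgainstPPoly_holds`): a natural proof `Q` establishes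
`L ∉ P/poly` for every language `L` whose slices have the property for infinitely many lengths
(Razborov–Rudich 1997, §2, "Usefulness"; Arora–Barak 2009, §23.1). [cite: RazborovRudich1997, §2 (usefulness)] [cite: AroraBarakCC2009, §23.1] -/
theorem IsNaturalProof.not_mem_PPoly' {Q : CombinatorialProperty} (hQ : IsNaturalProof Q)
    {L : Language Bool} (hL : ∃ᶠ n in atTop, L.sliceFn n ∈ Q n) : L ∉ PPoly :=
  hQ.not_mem_PPoly isUsefulAgainst_PPoly_of_isUsefulAgainstPPoly_holds hL

/-- The dichotomy form of the barrier, unconditionally: a natural proof against `P/poly` and a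
`2^{k^ε}`-hard pseudo-random generator family in `P/poly` do not both exist (Razborov–Rudich
1997, Thm. 4.1, the "self-defeating" reading: a natural proof of a strong lower bound would break
the very pseudo-random generators whose existence such lower bounds are meant to support).
[cite: RazborovRudich1997, Thm. 4.1] -/
theorem not_naturalProof_and_hardPRG :
    ¬ ((∃ Q : CombinatorialProperty, IsNaturalProof Q) ∧ HardPRGExist) :=
  fun h => not_exists_naturalProof_of_hardPRG h.2 h.1

end Literature.Barriers.PneNP
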